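import Literature.Computability.Cryptography.LWEPrimePowerProgDig
import Literature.Computability.Cryptography.LWEPrimePowerProgEstBridge
import Literature.Computability.Cryptography.LWEPrimePowerStrategy
import HarnessLib

/-!
# The Micciancio–Peikert machine, IV′: the list-level digit query IS the solver's digit query

Topic `Computability/Cryptography` (LWE), grouping namespace `LWE.MP12.Prog`, bridge between
`LWEPrimePowerProgDig.lean` (`digQueryL`, the digit query assembled on lists) and the strategy
(`LWEPrimePowerStrategy.digQuery` on the structured input `LWEPrimePowerLayout.layout (S, coins)`).
Proved material (no named fact) towards
`Literature.Computability.Cryptography.blprs_gapSVP_sqrt_dim_to_lwe_classical` (**pqc.S21**),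
hypothesis `h₂`: on a genuine input (samples `S`, coin string `r` of length `≥ numCoins`, the
parameter tuple `Pof`), **`digQueryL_eq`**: the list-level digit query of the call
`(c, i', k, t, h, b)` at selected step `i₀` and loop state `L` is the list form `toLData` of the block of
`digQuery (layout (S, coins)) i₀ (c, i', k, t, h, b) L`, paired with the list of the call's coin slice.

## References

* D. Micciancio, C. Peikert, *Trapdoors for lattices: simpler, tighter, faster, smaller*, EUROCRYPT 2012,
  LNCS 7237; full version IACR ePrint 2011/501, §3, Thm. 3.1 proof (pp. 15–16). [MicciancioPeikert2012]
-/

noncomputable section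

namespace Literature.Computability.Cryptography

namespace LWE

namespace MP12

namespace Prog

open _root_.Computability Literature.Computability.Complexity Finset

/-! ### List helpers -/

section ListHelpers

variable {α : Type}

/-- Setting an entry of `List.ofFn` is `List.ofFn` of the updated function. [folklore] -/
theorem set_ofFn {n : ℕ} (f : Fin n → α) (i : Fin n) (y : α) :
    (List.ofFn f).set i.val y = List.ofFn (Function.update f i y) := by
  apply List.ext_getElem
  · simp
  · intro j h₁ h₂
    simp only [List.getElem_set, List.getElem_ofFn, Function.update]
    by_cases hij : i.val = j
    · subst hij
      simp
    · rw [if_neg hij, dif_neg (fun h => hij (congrArg Fin.val h).symm)]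

end ListHelpers

/-! ### The genuine digit context -/

section Bridge

variable {d e K' m N T N' m' ℓ G : ℕ}
variable (S : Fin (numSamples d e K' m N T N' m') → (Fin d → ZMod (2 ^ e)) × ZMod (2 ^ e)) (r : List Bool)
  (c : Fin d) (i' : Fin e) (k : Fin 2) (t : Fin T) (h : Fin 2) (b : Fin N) (i₀ L : ℕ)

/-- The genuine digit context of the call. [folklore] -/
def digCtxOf : DigCtx :=
  ((Pof d e K' m N T N' m' ℓ G, (d, (m, e))), (List.ofFn fun i => toItem (S i), (r, (c.val, (i'.val, (k.val, (t.val, (h.val, (b.val, (i₀, L))))))))))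

variable {S r c i' k t h b i₀ L}

/-- A reduced power of two, as a residue. [folklore] -/
theorem cast_pw2 (x : ℕ) (hx : x ≤ e) : ((pw2 (Pof d e K' m N T N' m' ℓ G) e x : ℕ) : ZMod (2 ^ e)) = 2 ^ x := by
  simp only [pw2, Pof, PrmT.Q, Nat.min_eq_left hx, Nat.max_eq_left (Nat.two_pow_pos e)]
  rw [ZMod.natCast_mod, Nat.cast_pow, Nat.cast_ofNat]

/-- The scalar segment offsets of the genuine tuple. [folklore] -/
theorem digOff_Pof (sh : ℕ) : digOff (Pof d e K' m N T N' m' ℓ G) sh = rEl e m N' + rEs d e N' + sh * rX d e m N T := rfl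

/-- **The pipeline of one item**: aggregate (level `i₀`), candidate shift, coordinate bump, `τ`-shift, on
lists versus on the solver's typed data. [cite: MicciancioPeikert2012, Thm. 3.1 proof (pp. 15–16)] -/
theorem coreItem_eq (hr : numCoins d e m N T N' ℓ ≤ r.length) (vec : Fin (K' + 1) → (Fin d → ZMod (2 ^ e)) × ZMod (2 ^ e))
    (lsc rsc : ZMod (2 ^ e)) (lN rN : ℕ) (hl : ((lN : ℕ) : ZMod (2 ^ e)) = lsc) (hrs : ((rN : ℕ) : ZMod (2 ^ e)) = rsc) :
    let C := trialCtxOf (digCtxOf (ℓ := ℓ) (G := G) S r c i' k t h b i₀ L)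
    let td := (layout d e K' m N T N' m' ℓ (S, coinsOf d e m N T N' ℓ r)).2.1 c i' k t
    shiftItem (2 ^ e) C.τ (bumpCoord (2 ^ e) c.val (lN * C.cm) (shiftByCand (2 ^ e) c.val C.v
      (addB (2 ^ e) (aggItem (2 ^ e) d (List.ofFn fun q' => toItem (vec q'))) (rN * C.g₀)))) =
      toItem (shiftSample td.1 (xmap c (gen 2 e (i₀ + 1 + i'.val)) (candShift c i'.val L k.val) (lsc, item K' (gen 2 e i₀) (vec, rsc)))) := by
  haveI : NeZero (2 ^ e) := ⟨(Nat.two_pow_pos e).ne'⟩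
  have hQ1 : 1 ≤ 2 ^ e := Nat.two_pow_pos e
  intro C td
  -- the derived numbers of the context
  have hC : C = trialCtxOf (digCtxOf (ℓ := ℓ) (G := G) S r c i' k t h b i₀ L) := rfl
  have hτC : C.τ = (List.range d).map fun cc => scalarAt r e (digOff (Pof d e K' m N T N' m' ℓ G) 5 + trialPos e T c.val i'.val k.val t.val * d + cc) := rfl
  have hvC : C.v = (L + k.val * pw2 (Pof d e K' m N T N' m' ℓ G) e i'.val) % 2 ^ e := by
    show (L + k.val * pw2 (Pof d e K' m N T N' m' ℓ G) e i'.val) % max (2 ^ e) 1 = _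
    rw [Nat.max_eq_left hQ1]
  have hcmC : C.cm = pw2 (Pof d e K' m N T N' m' ℓ G) e (e - (i₀ + 1 + i'.val)) := rfl
  have hg₀C : C.g₀ = pw2 (Pof d e K' m N T N' m' ℓ G) e (e - i₀) := rfl
  -- `τ`
  have hτ : ∀ cc : Fin d, td.1 cc = ((scalarAt r e (digOff (Pof d e K' m N T N' m' ℓ G) 5 + trialPos e T c.val i'.val k.val t.val * d + cc.val) : ℕ) :
      ZMod (2 ^ e)) := by
    intro cc
    show ((layout d e K' m N T N' m' ℓ (S, coinsOf d e m N T N' ℓ r)).2.1 c i' k t).1 cc = _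
    have hb : digOff (Pof d e K' m N T N' m' ℓ G) 5 + trialPos e T c.val i'.val k.val t.val * d + cc.val < numScalars d e m N T N' := by
      have := idx₄_lt c i' k t cc
      simp only [digOff, Pof, PrmT.e, PrmT.N', PrmT.m, PrmT.d, PrmT.T, PrmT.N]
      unfold numScalars rEl rEs rX rTau trialPos
      omega
    rw [layout_dig_tau, cast_scalarAt hr ⟨_, hb⟩]
    congr 1
    exact Fin.ext (by simp only [digOff, Pof, PrmT.e, PrmT.N', PrmT.m, PrmT.d, PrmT.T, PrmT.N]; unfold rEl rEs rX; ring)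
  -- the solver's item, explicitly
  set A : Fin d → ZMod (2 ^ e) := (∑ q', vec q').1 with hA
  set w : ZMod (2 ^ e) := ((L + k.val * 2 ^ i'.val : ℕ) : ZMod (2 ^ e)) with hw
  set cm : ZMod (2 ^ e) := gen 2 e (i₀ + 1 + i'.val) with hcm
  have hRHS : shiftSample td.1 (xmap c cm (candShift c i'.val L k.val) (lsc, item K' (gen 2 e i₀) (vec, rsc))) =
      (A + Pi.single c (lsc * cm), ((∑ q', vec q').2 + rsc * gen 2 e i₀ - A c * w) + (A + Pi.single c (lsc * cm)) ⬝ᵥ td.1) := by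
    simp only [xmap, digitTransform, shiftSample, item, hybridize, sumSamples, candShift, dotProduct_neg, dotProduct_single, ← hA, ← hw]
    exact Prod.ext rfl (by ring)
  rw [hRHS, toItem]
  -- the list-level pieces
  have hget : ∀ (cc : Fin d) (q' : Fin (K' + 1)), (toItem (vec q')).1.getD cc.val 0 = ((vec q').1 cc).val := fun cc q' => by
    rw [toItem]
    exact getD_ofFn _ _ cc
  have ha : (List.range d).map (fun cc => sumMod (2 ^ e) ((List.ofFn fun q' => toItem (vec q')).map fun x => x.1.getD cc 0)) =
      List.ofFn fun cc : Fin d => (A cc).val := by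
    rw [map_range_eq_ofFn]
    congr 1
    funext cc
    rw [List.map_ofFn, sumMod_eq hQ1, List.sum_ofFn, hA, Prod.fst_sum, Finset.sum_apply, val_sum]
    congr 1
    exact Finset.sum_congr rfl fun q' _ => hget cc q'
  have hb0 : ((sumMod (2 ^ e) ((List.ofFn fun q' => toItem (vec q')).map Prod.snd) : ℕ) : ZMod (2 ^ e)) = (∑ q', vec q').2 := by
    rw [List.map_ofFn, sumMod_eq hQ1, List.sum_ofFn, ZMod.natCast_mod, Nat.cast_sum, Prod.snd_sum]
    exact Finset.sum_congr rfl fun q' _ => by simp [toItem]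
  have hg₀ : ((C.g₀ : ℕ) : ZMod (2 ^ e)) = gen 2 e i₀ := by
    rw [hg₀C, cast_pw2 _ (Nat.sub_le e i₀), gen, Nat.cast_ofNat]
  have hcm' : ((C.cm : ℕ) : ZMod (2 ^ e)) = cm := by
    rw [hcmC, cast_pw2 _ (Nat.sub_le e _), hcm, gen, Nat.cast_ofNat]
  have hv : ((C.v : ℕ) : ZMod (2 ^ e)) = w := by
    rw [hvC, ZMod.natCast_mod, Nat.cast_add, Nat.cast_mul, cast_pw2 _ i'.2.le, hw]
    push_cast
    ring
  simp only [aggItem, addB, shiftByCand, bumpCoord, shiftItem, Nat.max_eq_left hQ1, ha]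
  rw [getD_ofFn _ _ c, set_ofFn]
  -- the bumped coordinate
  have hnew : ((A c).val + lN * C.cm) % 2 ^ e = ((A + Pi.single c (lsc * cm) : Fin d → ZMod (2 ^ e)) c).val := by
    refine eq_val_of_cast_eq (Nat.mod_lt _ (Nat.two_pow_pos e)) ?_
    rw [ZMod.natCast_mod, Nat.cast_add, Nat.cast_mul, ZMod.natCast_zmod_val, hl, hcm', Pi.add_apply, Pi.single_eq_same]
  have hupd : Function.update (fun cc : Fin d => (A cc).val) c (((A c).val + lN * C.cm) % 2 ^ e) =
      fun cc => ((A + Pi.single c (lsc * cm) : Fin d → ZMod (2 ^ e)) cc).val := by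
    funext cc
    by_cases hcc : cc = c
    · subst hcc
      rw [Function.update_self, hnew]
    · rw [Function.update_of_ne hcc, Pi.add_apply, Pi.single_eq_of_ne hcc, add_zero]
  rw [hupd]
  refine Prod.ext rfl ?_
  -- the `b`-value through the residues
  have hdot : ((dotMod (2 ^ e) (List.ofFn fun cc : Fin d => ((A + Pi.single c (lsc * cm) : Fin d → ZMod (2 ^ e)) cc).val) C.τ : ℕ) :
      ZMod (2 ^ e)) = (A + Pi.single c (lsc * cm)) ⬝ᵥ td.1 := by
    rw [hτC, map_range_eq_ofFn, dotMod_eq hQ1, zipWith_ofFn, List.sum_ofFn, ZMod.natCast_mod, Nat.cast_sum, dotProduct]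
    refine Finset.sum_congr rfl fun cc _ => ?_
    rw [Nat.cast_mul, ZMod.natCast_zmod_val, hτ cc]
  refine eq_val_of_cast_eq (Nat.mod_lt _ (Nat.two_pow_pos e)) ?_
  rw [ZMod.natCast_mod, Nat.cast_add, hdot, ZMod.natCast_mod, Nat.cast_add, cast_sub_mod, Nat.cast_mul, ZMod.natCast_zmod_val, hv,
    ZMod.natCast_mod, Nat.cast_add, Nat.cast_mul, hb0, hrs, hg₀]
  ring


/-- The block of `x`-items of the trial is `xItemL` itemwise. [cite: MicciancioPeikert2012, Thm. 3.1 proof (pp. 15–16)] -/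
theorem xItemL_eq (hr : numCoins d e m N T N' ℓ ≤ r.length) (q : Fin m) :
    let C := trialCtxOf (digCtxOf (ℓ := ℓ) (G := G) S r c i' k t h b i₀ L)
    let td := (layout d e K' m N T N' m' ℓ (S, coinsOf d e m N T N' ℓ r)).2.1 c i' k t
    xItemL C q.val = toItem (qx td.1 (fun q => xmap c (gen 2 e (i₀ + 1 + i'.val)) (candShift c i'.val L k.val) (xpair K' i₀ (td.2.1.1 b q))) q) := by
  intro C td
  have hQ1 : 1 ≤ 2 ^ e := Nat.two_pow_pos e
  -- the raw samples and the two scalars of the item, read off the layout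
  have htp : C.tp = trialPos e T c.val i'.val k.val t.val := rfl
  have hraw : digRaw C ((C.P.e + 1) * (C.P.N' * (C.P.m * C.P.K))) q.val = List.ofFn fun q' => toItem ((td.2.1.1 b q).2.1 q') := by
    show sliceAt (List.ofFn fun i => toItem (S i)) ((e + 1) * (N' * (m * (K' + 1))) + trialPos e T c.val i'.val k.val t.val * (N * (m * (K' + 1))) +
      (b.val * m + q.val) * (K' + 1)) (K' + 1) = _
    have hb : (e + 1) * (N' * (m * (K' + 1))) + trialPos e T c.val i'.val k.val t.val * (N * (m * (K' + 1))) + (b.val * m + q.val) * (K' + 1) + (K' + 1) ≤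
        numSamples d e K' m N T N' m' := by
      have h1 := idx₄_lt c i' k t (⟨(b.val * m + q.val) * (K' + 1) + K', idx₂_lt b q (Fin.last K')⟩ : Fin (N * (m * (K' + 1))))
      unfold numSamples nXs trialPos nEs; simp at h1; omega
    rw [sliceAt_ofFn _ _ _ hb]
    congr 1
    funext q'
    show _ = toItem ((((layout d e K' m N T N' m' ℓ (S, coinsOf d e m N T N' ℓ r)).2.1 c i' k t).2.1.1 b q).2.1 q')
    rw [layout_dig_xs]
    congr 2
    exact Fin.ext (by unfold nEs; simp only; ring)
  have hl : ((digScalar C (digOff C.P 0) q.val : ℕ) : ZMod (2 ^ e)) = (td.2.1.1 b q).1 := by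
    show ((scalarAt r e (digOff (Pof d e K' m N T N' m' ℓ G) 0 + trialPos e T c.val i'.val k.val t.val * (N * m) + (b.val * m + q.val)) : ℕ) : ZMod (2 ^ e)) =
      (((layout d e K' m N T N' m' ℓ (S, coinsOf d e m N T N' ℓ r)).2.1 c i' k t).2.1.1 b q).1
    have hb : digOff (Pof d e K' m N T N' m' ℓ G) 0 + trialPos e T c.val i'.val k.val t.val * (N * m) + (b.val * m + q.val) < numScalars d e m N T N' := by
      have := dig_scalar_lt d e m N T c i' k t b q
      rw [digOff_Pof]; unfold numScalars; omega
    rw [layout_dig_xl, cast_scalarAt hr ⟨_, hb⟩]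
    congr 1
    exact Fin.ext (by simp only [digOff_Pof]; omega)
  have hrs : ((digScalar C (digOff C.P 1) q.val : ℕ) : ZMod (2 ^ e)) = (td.2.1.1 b q).2.2 := by
    show ((scalarAt r e (digOff (Pof d e K' m N T N' m' ℓ G) 1 + trialPos e T c.val i'.val k.val t.val * (N * m) + (b.val * m + q.val)) : ℕ) : ZMod (2 ^ e)) =
      (((layout d e K' m N T N' m' ℓ (S, coinsOf d e m N T N' ℓ r)).2.1 c i' k t).2.1.1 b q).2.2
    have hb : digOff (Pof d e K' m N T N' m' ℓ G) 1 + trialPos e T c.val i'.val k.val t.val * (N * m) + (b.val * m + q.val) < numScalars d e m N T N' := by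
      have := dig_scalar_lt d e m N T c i' k t b q
      rw [digOff_Pof]; unfold numScalars; omega
    rw [layout_dig_xr, cast_scalarAt hr ⟨_, hb⟩]
    congr 1
    exact Fin.ext (by simp only [digOff_Pof]; omega)
  -- the pipeline
  have hcore := coreItem_eq (m' := m') (G := G) (S := S) (c := c) (i' := i') (k := k) (t := t) (h := h) (b := b) (i₀ := i₀) (L := L) hr
    (td.2.1.1 b q).2.1 (td.2.1.1 b q).1 (td.2.1.1 b q).2.2 _ _ hl hrs
  have hx : xItemL C q.val = shiftItem (2 ^ e) C.τ (bumpCoord (2 ^ e) c.val (digScalar C (digOff C.P 0) q.val * C.cm) (shiftByCand (2 ^ e) c.val C.v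
      (addB (2 ^ e) (aggItem (2 ^ e) d (digRaw C ((C.P.e + 1) * (C.P.N' * (C.P.m * C.P.K))) q.val)) (digScalar C (digOff C.P 1) q.val * C.g₀)))) := rfl
  dsimp only at hcore
  rw [hx, hraw, hcore]
  rfl

/-- The block of `y`-items of the trial is `yItemL` itemwise. [cite: MicciancioPeikert2012, Thm. 3.1 proof (pp. 15–16)] -/
theorem yItemL_eq (hr : numCoins d e m N T N' ℓ ≤ r.length) (q : Fin m) :
    let C := trialCtxOf (digCtxOf (ℓ := ℓ) (G := G) S r c i' k t h b i₀ L)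
    let td := (layout d e K' m N T N' m' ℓ (S, coinsOf d e m N T N' ℓ r)).2.1 c i' k t
    yItemL C q.val = toItem (qy (gen 2 e (i₀ + 1)) td.1 (fun q => ymap c (gen 2 e (i₀ + 1 + i'.val)) (candShift c i'.val L k.val) (ypair K' i₀ (td.2.1.2 b q))) q) := by
  intro C td
  haveI : NeZero (2 ^ e) := ⟨(Nat.two_pow_pos e).ne'⟩
  have hQ1 : 1 ≤ 2 ^ e := Nat.two_pow_pos e
  have hraw : digRaw C ((C.P.e + 1) * (C.P.N' * (C.P.m * C.P.K)) + C.P.d * (C.P.e * (2 * (C.P.T * (C.P.N * (C.P.m * C.P.K)))))) q.val =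
      List.ofFn fun q' => toItem ((td.2.1.2 b q).2.2.1 q') := by
    show sliceAt (List.ofFn fun i => toItem (S i)) ((e + 1) * (N' * (m * (K' + 1))) + d * (e * (2 * (T * (N * (m * (K' + 1)))))) +
      trialPos e T c.val i'.val k.val t.val * (N * (m * (K' + 1))) + (b.val * m + q.val) * (K' + 1)) (K' + 1) = _
    have hb : (e + 1) * (N' * (m * (K' + 1))) + d * (e * (2 * (T * (N * (m * (K' + 1)))))) + trialPos e T c.val i'.val k.val t.val * (N * (m * (K' + 1))) +
        (b.val * m + q.val) * (K' + 1) + (K' + 1) ≤ numSamples d e K' m N T N' m' := by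
      have h1 := idx₄_lt c i' k t (⟨(b.val * m + q.val) * (K' + 1) + K', idx₂_lt b q (Fin.last K')⟩ : Fin (N * (m * (K' + 1))))
      unfold numSamples nXs trialPos nEs; simp at h1; omega
    rw [sliceAt_ofFn _ _ _ hb]
    congr 1
    funext q'
    show _ = toItem ((((layout d e K' m N T N' m' ℓ (S, coinsOf d e m N T N' ℓ r)).2.1 c i' k t).2.1.2 b q).2.2.1 q')
    rw [layout_dig_ys]
    congr 2
    exact Fin.ext (by unfold nEs nXs; simp only; ring)
  have hsc : ∀ (sh : ℕ) (x : ZMod (2 ^ e)) (hsh : sh = 2 ∨ sh = 3 ∨ sh = 4),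
      x = scalarsOf d e m N T N' (split2 _ _ (coinsOf d e m N T N' ℓ r)).1 ⟨rEl e m N' + (rEs d e N' + (sh * rX d e m N T +
        (trialPos e T c.val i'.val k.val t.val * (N * m) + (b.val * m + q.val)))), by
          have := dig_scalar_lt d e m N T c i' k t b q; unfold numScalars; rcases hsh with h0 | h0 | h0 <;> subst h0 <;> omega⟩ →
      ((digScalar C (digOff C.P sh) q.val : ℕ) : ZMod (2 ^ e)) = x := by
    intro sh x hsh hx
    show ((scalarAt r e (digOff (Pof d e K' m N T N' m' ℓ G) sh + trialPos e T c.val i'.val k.val t.val * (N * m) + (b.val * m + q.val)) : ℕ) : ZMod (2 ^ e)) = x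
    have hb : digOff (Pof d e K' m N T N' m' ℓ G) sh + trialPos e T c.val i'.val k.val t.val * (N * m) + (b.val * m + q.val) < numScalars d e m N T N' := by
      have := dig_scalar_lt d e m N T c i' k t b q
      rw [digOff_Pof]; unfold numScalars
      rcases hsh with h2 | h3 | h4
      · subst h2; omega
      · subst h3; omega
      · subst h4; omega
    rw [hx, cast_scalarAt hr ⟨_, hb⟩]
    congr 1
    exact Fin.ext (by simp only [digOff_Pof]; ring)
  have hρ := hsc 2 (td.2.1.2 b q).1 (Or.inl rfl) (by
    show (((layout d e K' m N T N' m' ℓ (S, coinsOf d e m N T N' ℓ r)).2.1 c i' k t).2.1.2 b q).1 = _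
    rw [layout_dig_yρ]; congr 1; exact Fin.ext (by simp only; ring))
  have hl := hsc 3 (td.2.1.2 b q).2.1 (Or.inr (Or.inl rfl)) (by
    show (((layout d e K' m N T N' m' ℓ (S, coinsOf d e m N T N' ℓ r)).2.1 c i' k t).2.1.2 b q).2.1 = _
    rw [layout_dig_yl]; congr 1; exact Fin.ext (by simp only; ring))
  have hrs := hsc 4 (td.2.1.2 b q).2.2.2 (Or.inr (Or.inr rfl)) (by
    show (((layout d e K' m N T N' m' ℓ (S, coinsOf d e m N T N' ℓ r)).2.1 c i' k t).2.1.2 b q).2.2.2 = _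
    rw [layout_dig_yr]; congr 1; exact Fin.ext (by simp only; ring))
  have hg₁ : (((trialCtxOf (digCtxOf (ℓ := ℓ) (G := G) S r c i' k t h b i₀ L)).g₁ : ℕ) : ZMod (2 ^ e)) = gen 2 e (i₀ + 1) := by
    show ((pw2 (Pof d e K' m N T N' m' ℓ G) e (e - (i₀ + 1)) : ℕ) : ZMod (2 ^ e)) = _
    rw [cast_pw2 _ (Nat.sub_le e _), gen, Nat.cast_ofNat]
  -- the pipeline, then the re-spread
  have hcore := coreItem_eq (m' := m') (G := G) (S := S) (c := c) (i' := i') (k := k) (t := t) (h := h) (b := b) (i₀ := i₀) (L := L) hr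
    (td.2.1.2 b q).2.2.1 (td.2.1.2 b q).2.1 (td.2.1.2 b q).2.2.2 _ _ hl hrs
  have hy : yItemL C q.val = addB (2 ^ e) (shiftItem (2 ^ e) C.τ (bumpCoord (2 ^ e) c.val (digScalar C (digOff C.P 3) q.val * C.cm) (shiftByCand (2 ^ e) c.val C.v
      (addB (2 ^ e) (aggItem (2 ^ e) d (digRaw C ((C.P.e + 1) * (C.P.N' * (C.P.m * C.P.K)) + C.P.d * (C.P.e * (2 * (C.P.T * (C.P.N * (C.P.m * C.P.K)))))) q.val))
        (digScalar C (digOff C.P 4) q.val * C.g₀))))) (digScalar C (digOff C.P 2) q.val * C.g₁) := rfl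
  dsimp only at hcore
  rw [hy, hraw, hcore]
  simp only [qy, Function.comp_apply, qySample, respreadSample, ymap, ypair, xpair, toItem, shiftSample, addB, Nat.max_eq_left hQ1]
  refine Prod.ext rfl ?_
  refine eq_val_of_cast_eq (Nat.mod_lt _ (Nat.two_pow_pos e)) ?_
  rw [ZMod.natCast_mod, Nat.cast_add, Nat.cast_mul, ZMod.natCast_zmod_val, hρ, hg₁]

/-- **The list-level digit query is the solver's digit query** on the layout of `(S, coins)`.
[cite: MicciancioPeikert2012, Thm. 3.1 proof (pp. 15–16)] -/
theorem digQueryL_eq (hr : numCoins d e m N T N' ℓ ≤ r.length) :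
    digQueryL (digCtxOf (ℓ := ℓ) (G := G) S r c i' k t h b i₀ L) =
      (toLData (digQuery (layout d e K' m N T N' m' ℓ (S, coinsOf d e m N T N' ℓ r)) i₀ (c, (i', (k, (t, (h, b))))) L).1,
        List.ofFn (digQuery (layout d e K' m N T N' m' ℓ (S, coinsOf d e m N T N' ℓ r)) i₀ (c, (i', (k, (t, (h, b))))) L).2) := by
  have hQ1 : 1 ≤ 2 ^ e := Nat.two_pow_pos e
  set C := trialCtxOf (digCtxOf (ℓ := ℓ) (G := G) S r c i' k t h b i₀ L) with hC
  have hh : C.h = h.val := rfl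
  have hb' : C.b = b.val := rfl
  have htp : C.tp = trialPos e T c.val i'.val k.val t.val := rfl
  -- the coin slice
  have hcoin : ∀ (off : ℕ) (v : Fin ℓ → Bool) (hoff : off = 0 ∨ off = cX d e N T ℓ),
      (∀ tt : Fin ℓ, v tt = coinsOf d e m N T N' ℓ r ⟨numScalars d e m N T N' * e + (cE e N' ℓ + (off +
        (trialPos e T c.val i'.val k.val t.val * (N * ℓ) + (b.val * ℓ + tt.val)))), by
          have := dig_coin_lt d e N T ℓ c i' k t b tt; unfold numCoins numCallBits; rcases hoff with h0 | h0 <;> subst h0 <;> omega⟩) →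
      strSliceAt r (numScalars d e m N T N' * e + (e + 1) * (N' * ℓ) + off + trialPos e T c.val i'.val k.val t.val * (N * ℓ) + b.val * ℓ) ℓ = List.ofFn v := by
    intro off v hoff hv
    rw [strSliceAt_eq, sliceAt_eq_ofFn_getD r _ ℓ false]
    · congr 1
      funext tt
      rw [hv tt, coinsOf]
      simp only
      congr 1
      unfold cE; ring
    · have h1 : (trialPos e T c.val i'.val k.val t.val + 1) * (N * ℓ) ≤ cX d e N T ℓ := by
        unfold cX
        calc (trialPos e T c.val i'.val k.val t.val + 1) * (N * ℓ) ≤ (d * (e * (2 * T))) * (N * ℓ) :=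
              Nat.mul_le_mul_right _ (trialPos_lt d e T c i' k t)
          _ = d * (e * (2 * (T * (N * ℓ)))) := by ring
      have h2 : (b.val + 1) * ℓ ≤ N * ℓ := Nat.mul_le_mul_right _ b.2
      have h3 : (trialPos e T c.val i'.val k.val t.val + 1) * (N * ℓ) = trialPos e T c.val i'.val k.val t.val * (N * ℓ) + N * ℓ := by ring
      have h4 : (b.val + 1) * ℓ = b.val * ℓ + ℓ := by ring
      have h5 : numCoins d e m N T N' ℓ = numScalars d e m N T N' * e + ((e + 1) * (N' * ℓ) + (cX d e N T ℓ + cX d e N T ℓ)) := rfl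
      rcases hoff with h0 | h0 <;> subst h0 <;> omega
  -- the two halves
  have hnum : numScalarsL (Pof d e K' m N T N' m' ℓ G) = numScalars d e m N T N' := rfl
  show (((Pof d e K' m N T N' m' ℓ G).d, ((Pof d e K' m N T N' m' ℓ G).Q, if decide (C.h = 0) then (List.range m).map (xItemL C) else (List.range m).map (yItemL C))),
    strSliceAt r (numScalarsL (Pof d e K' m N T N' m' ℓ G) * (Pof d e K' m N T N' m' ℓ G).e + ((Pof d e K' m N T N' m' ℓ G).e + 1) *
      ((Pof d e K' m N T N' m' ℓ G).N' * (Pof d e K' m N T N' m' ℓ G).ℓ) + (if decide (C.h = 0) then 0 else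
        (Pof d e K' m N T N' m' ℓ G).d * ((Pof d e K' m N T N' m' ℓ G).e * (2 * ((Pof d e K' m N T N' m' ℓ G).T * ((Pof d e K' m N T N' m' ℓ G).N *
          (Pof d e K' m N T N' m' ℓ G).ℓ))))) + C.tp * ((Pof d e K' m N T N' m' ℓ G).N * (Pof d e K' m N T N' m' ℓ G).ℓ) + C.b * (Pof d e K' m N T N' m' ℓ G).ℓ)
      (Pof d e K' m N T N' m' ℓ G).ℓ) = _
  rw [hnum, hh, hb', htp]
  simp only [Pof, PrmT.d, PrmT.Q, PrmT.e, PrmT.N', PrmT.ℓ, PrmT.T, PrmT.N, digQuery, toLData]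
  rcases Fin.exists_fin_two.mp ⟨h, rfl⟩ with hh0 | hh1
  · subst hh0
    simp only [Fin.val_zero, decide_true, if_true, Nat.add_zero]
    refine Prod.ext (Prod.ext rfl (Prod.ext rfl ?_)) ?_
    · show (List.range m).map (xItemL C) = List.ofFn _
      rw [map_range_eq_ofFn]
      congr 1
      funext q
      exact xItemL_eq (G := G) (h := 0) hr q
    · refine hcoin 0 _ (Or.inl rfl) fun tt => ?_
      show (((layout d e K' m N T N' m' ℓ (S, coinsOf d e m N T N' ℓ r)).2.1 c i' k t).2.2.1 b) tt = _
      rw [layout_dig_cx]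
      congr 1
      exact Fin.ext (by simp only [Nat.zero_add])
  · subst hh1
    simp only [Fin.val_one, one_ne_zero, decide_false, if_false, Bool.false_eq_true]
    refine Prod.ext (Prod.ext rfl (Prod.ext rfl ?_)) ?_
    · show (List.range m).map (yItemL C) = List.ofFn _
      rw [map_range_eq_ofFn]
      congr 1
      funext q
      exact yItemL_eq (G := G) (h := 1) hr q
    · refine hcoin (cX d e N T ℓ) _ (Or.inr rfl) fun tt => ?_
      show (((layout d e K' m N T N' m' ℓ (S, coinsOf d e m N T N' ℓ r)).2.1 c i' k t).2.2.2 b) tt = _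
      rw [layout_dig_cy]

end Bridge

end Prog

end MP12

end LWE

end Literature.Computability.Cryptography

end
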